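import Mathlib
import HarnessLib
import Summits.BirchSwinnertonDyer.BirchSwinnertonDyer.Theses.ManinLocalTwoThree
import Summits.BirchSwinnertonDyer.BirchSwinnertonDyer.Theorems.ManinLocalTwoThreeCDivisionShape185Flat
import Literature.NumberTheory.Automorphic.UnboundedDenominators

/-!
# Lines/kummer_diamond_flat_candidate.lean — CANDIDATE (width seat p3 gen 19, 2026-08-30T06:2xZ): the line of record `kummer_diamond` with its law
# FLATTENED — C2 `ManinOddAtFour` ⟸ CDT Thm 1.0.1 (PRINTED, verbatim) ∧ E-es-185♭, where E-es-185♭ = E-es-185 `IndexFourForcesFreyTwistShape` restricted to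
# index-4 data that are GIVEN `|c₀| = 2` AND three rational 2-torsion abscissae.  Point: the es/p2/LEAD port of E-es-185 consumed E-an-152d (full rational
# 2-torsion in the index-4 world), so far a theorem only mod F★ ∧ CES; with the kernel theorem `CDivTranslate.exists_three_hasRationalTwoTorsionX_of_indexFour`
# (p3 g19 p762291: lattice clause ∧ |c₀| = 2 ∧ Λ₁ = 2Λ₀ ⟹ full rational 2-torsion, by Aut(ℂ)-rigidity of the half-period values of the c-division-witness
# translates anchored by ϑ₄(2τ)³ϑ₄(2q₀τ)) the composition supplies the 2-torsion itself, and the law only has to turn «index 4 + full rational 2-torsion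
# (+ |c₀| = 2)» into «2⁵ ∣ N ∧ Frey-twist shape».  `shape185Flat_of_shape185 : E-es-185 → E-es-185♭` (nothing lost).  COMPOSITION
# `CDivTranslate.maninOddAtFour_of_CDTInt_shape185Flat` (p762452; E-es-186♭ = Tate family C inside, p2 p758063; modularity = C2's 4th binder).
# HONEST FRAMING: CONDITIONAL reduction; CDT printed/statement-only; E-es-185♭ OPEN in the tree (paper-proved per MEMO-es §59 / ref1 §R215); BSD is not proved;
# Manin's conjecture is not proved.
-/

set_option autoImplicit false
set_option linter.dupNamespace false

noncomputable section

open Literature.NumberTheory.EllipticCurves Literature.NumberTheory.EllipticCurves.ModularForms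
open Summit.BirchSwinnertonDyer.Rank1Residual.ManinAdditive.KummerDiamond

namespace Summit.BirchSwinnertonDyer.BirchSwinnertonDyer.Cruxes.ManinOddAtFour.KummerDiamondFlat

/-- STUB (PRINTED) CDT Theorem 1.0.1 as printed (`CalegariDimitrovTang2025_unboundedDenominators`, ℤ-coefficients); CITE-ONLY. -/
theorem stub_CDT : Literature.NumberTheory.Automorphic.CalegariDimitrovTang2025_unboundedDenominators := by
  sorry

/-- STUB (LAW) E-es-185♭: for a lattice-optimal `X₀(N)`-datum of a globally minimal curve with `|c₀| = 2`, `Λ₁(f) = 2Λ₀(f)` and three rational `2`-torsion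
abscissae, `2⁵ ∣ N` and the curve has the Frey-twist shape `y² = x(x − 2s²)(x − t²)` (`s` even, `t` odd).  Weaker than E-es-185 (`CDivTranslate.shape185Flat_of_shape185`).
Hardest (only) stub. -/
theorem stub_shape185Flat :
    ∀ (W₀ : WeierstrassCurve ℚ) [W₀.IsElliptic] [W₀.IsGloballyMinimal] {N : ℕ} [NeZero N] (D₀ : ModularParametrizationData W₀ N),
      (∀ z ∈ D₀.L.lattice, ∃ w ∈ periodLattice D₀.f, z = D₀.c * w) → D₀.c.natAbs = 2 →
      (∀ z : ℂ, z ∈ periodLatticeGamma1 D₀.f ↔ ∃ w ∈ periodLattice D₀.f, z = 2 * w) →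
      (∃ x₁ x₂ x₃ : ℚ, x₁ ≠ x₂ ∧ x₁ ≠ x₃ ∧ x₂ ≠ x₃ ∧
        Literature.NumberTheory.EllipticCurves.Greenberg1999.HasRationalTwoTorsionX W₀ x₁ ∧
        Literature.NumberTheory.EllipticCurves.Greenberg1999.HasRationalTwoTorsionX W₀ x₂ ∧
        Literature.NumberTheory.EllipticCurves.Greenberg1999.HasRationalTwoTorsionX W₀ x₃) →
      2 ^ 5 ∣ N ∧ HasFreyTwistShape W₀ := by
  sorry

/-- COMPOSITION (no sorry): `CDivTranslate.maninOddAtFour_of_CDTInt_shape185Flat` (p3 g19, p762452). -/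
theorem ManinOddAtFour_of :
    Summit.BirchSwinnertonDyer.BirchSwinnertonDyer.Theses.ManinLocalTwoThree.ManinOddAtFour :=
  Summit.BirchSwinnertonDyer.BirchSwinnertonDyer.Theorems.ManinLocalTwoThree.CDivTranslate.maninOddAtFour_of_CDTInt_shape185Flat
    stub_CDT stub_shape185Flat

end Summit.BirchSwinnertonDyer.BirchSwinnertonDyer.Cruxes.ManinOddAtFour.KummerDiamondFlat

end
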